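import Mathlib

/-!
# The order filter in MEMBERSHIP form, and peeling by certificates

Helper file for crux `stmt-CriticalPhenomena-4575` (`NoHeavyLowerTail`, route `PercNearOneGluingNoHeavy`),
new-inequality factory seat `prim-ineq-gen-3` (gen 26).  Everything here is PROVED; no definitions.

`…OrderedDifferencesOrderFilter` (gen 25, THEOREM A / A') peels an admissibly ranked family from either end when every LOCAL
matrix (`[V ⊆ X] + t [V ∩ X = ∅]` on a trace family, resp. `[W ∩ X = ∅] + t [W ⊆ X]` on a co-trace family) is INJECTIVE.  The
proof uses only one coordinate of the local solution: the class of the trace `∅`, which by admissibility is the member being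
peeled.  This file records the sharper statements:

* `dep_eq_zero_of_peelingCertificates` — the general frame: if the members can be enumerated so that, for each member `A`, the
  indicator of `A` on the not-yet-peeled members is a combination of the pencil columns (a "certificate" `λ_A`), every dependency
  vanishes.  (All peeling theorems are instances; gen 26 uses it with STAR certificates — columns incident to `A` — and with
  columns incident to `A` or to a member comparable with `A`, memo `FINDINGS-gen26.md` F26-9.)
* `dep_eq_zero_of_cotraceLocal_mem`, `dep_eq_zero_of_traceLocal_mem` — THEOREM A' / A with the local hypothesis weakened from
  "the local matrix is injective" to "every local solution has `∅`-coordinate `0`" (equivalently: `e_∅` lies in the row space of the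
  local matrix).  This is strictly stronger in practice: for the framed hard-core family `{∅,01,023,24,0124,15,1245,1345,012345}` of
  gen 25 the determinant form of the order filter is stuck in every one of its 427 admissible orders (golden-ratio roots in both
  directions), while the membership form peels it completely in every order (exact computation, gen 26).
(prim-ineq-gen-3 gen 26, 2026-08-25.)
-/

namespace Summit.CriticalPhenomena.PercolationContinuityZ3.Theorems

namespace OrderedDifferences

open Finset
open scoped FinsetFamily

variable {α : Type*} [DecidableEq α] {K : Type*} [Field K]

/-- **Peeling by certificates.**  Let `c` be a dependency of the pencil rows of `𝒜` at `t` on the column set `𝒞`, and let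
`r : Finset α → ℕ` rank the members (a peeling order; ties allowed).  Suppose that for every `A ∈ 𝒜` there is a certificate
`λ : Finset α → K` with `∑_{E ∈ 𝒞} λ E · ([E ⊆ C] + t [E ∩ C = ∅]) = [C = A]` for all members `C` with `r A ≤ r C` (the members not
peeled before `A`).  Then `c = 0` on `𝒜`. -/
theorem dep_eq_zero_of_peelingCertificates (𝒜 : Finset (Finset α)) (r : Finset α → ℕ)
    (𝒞 : Finset (Finset α)) (t : K) (c : Finset α → K)
    (hdep : ∀ E ∈ 𝒞, ∑ C ∈ 𝒜, c C * ((if E ⊆ C then (1 : K) else 0) +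
      t * (if Disjoint E C then (1 : K) else 0)) = 0)
    (hcert : ∀ A ∈ 𝒜, ∃ lam : Finset α → K, ∀ C ∈ 𝒜, r A ≤ r C →
      ∑ E ∈ 𝒞, lam E * ((if E ⊆ C then (1 : K) else 0) + t * (if Disjoint E C then (1 : K) else 0)) =
        if C = A then 1 else 0) :
    ∀ A ∈ 𝒜, c A = 0 := by
  classical
  suffices h : ∀ n : ℕ, ∀ A ∈ 𝒜, r A < n → c A = 0 from
    fun A hA => h (r A + 1) A hA (Nat.lt_succ_self _)
  intro n
  induction n with
  | zero => intro A _ h; exact absurd h (Nat.not_lt_zero _)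
  | succ n ih =>
    intro A hA hAn
    rcases Nat.lt_succ_iff_lt_or_eq.mp hAn with hlt | heq
    · exact ih A hA hlt
    · obtain ⟨lam, hlam⟩ := hcert A hA
      -- pair the certificate with the dependency: ∑_E lam E · (∑_C c C φ_E C) = 0
      have h0 : ∑ E ∈ 𝒞, lam E * (∑ C ∈ 𝒜, c C * ((if E ⊆ C then (1 : K) else 0) +
          t * (if Disjoint E C then (1 : K) else 0))) = 0 := by
        refine sum_eq_zero fun E hE => ?_
        rw [hdep E hE, mul_zero]
      -- exchange the sums: ∑_C c C · (∑_E lam E φ_E C) = 0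
      have hswap : ∑ C ∈ 𝒜, c C * (∑ E ∈ 𝒞, lam E * ((if E ⊆ C then (1 : K) else 0) +
          t * (if Disjoint E C then (1 : K) else 0))) =
          ∑ E ∈ 𝒞, lam E * (∑ C ∈ 𝒜, c C * ((if E ⊆ C then (1 : K) else 0) +
          t * (if Disjoint E C then (1 : K) else 0))) := by
        simp_rw [mul_sum]
        rw [sum_comm]
        refine sum_congr rfl fun E _ => sum_congr rfl fun C _ => ?_
        ring
      have h1 := hswap.trans h0
      -- members peeled earlier contribute 0, the others see the certificate
      rw [← sum_filter_add_sum_filter_not 𝒜 (fun C => r A ≤ r C)] at h1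
      have hrest : ∑ C ∈ 𝒜.filter (fun C => ¬ r A ≤ r C), c C * (∑ E ∈ 𝒞, lam E *
          ((if E ⊆ C then (1 : K) else 0) + t * (if Disjoint E C then (1 : K) else 0))) = 0 := by
        refine sum_eq_zero fun C hC => ?_
        obtain ⟨hC𝒜, hrC⟩ := mem_filter.mp hC
        rw [ih C hC𝒜 (by omega), zero_mul]
      rw [hrest, add_zero] at h1
      have hcert' : ∑ C ∈ 𝒜.filter (fun C => r A ≤ r C), c C * (∑ E ∈ 𝒞, lam E *
          ((if E ⊆ C then (1 : K) else 0) + t * (if Disjoint E C then (1 : K) else 0))) =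
          ∑ C ∈ 𝒜.filter (fun C => r A ≤ r C), c C * (if C = A then (1 : K) else 0) := by
        refine sum_congr rfl fun C hC => ?_
        obtain ⟨hC𝒜, hrC⟩ := mem_filter.mp hC
        rw [hlam C hC𝒜 hrC]
      rw [hcert'] at h1
      have hAmem : A ∈ 𝒜.filter (fun C => r A ≤ r C) := mem_filter.mpr ⟨hA, le_rfl⟩
      rw [sum_eq_single_of_mem A hAmem (fun C _ hCA => by simp [hCA])] at h1
      simpa using h1

/-- **Front peeling (co-trace local matrices).**  Let `r` rank the members of `𝒜` admissibly (`r B ≤ r C`, `B ≠ C`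
`⟹ B ⊄ C`), let the column set `𝒞` contain `B \ C` whenever `r B ≤ r C`, and let `c` be a dependency of the pencil rows
at `t` on `𝒞`.  If for every `A ∈ 𝒜` every solution `w` of the local system `[W ∩ X = ∅] + t [W ⊆ X]` on the
co-trace family `𝒲_A = {A \ C : C ∈ 𝒜, r A ≤ r C}` has `w ∅ = 0` (MEMBERSHIP form: the indicator of the co-trace `∅` lies in the
row space of the local matrix — weaker than injectivity), then `c = 0` on `𝒜`. -/
theorem dep_eq_zero_of_cotraceLocal_mem (𝒜 : Finset (Finset α)) (r : Finset α → ℕ)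
    (hr : ∀ B ∈ 𝒜, ∀ C ∈ 𝒜, B ≠ C → r B ≤ r C → ¬ B ⊆ C)
    (𝒞 : Finset (Finset α)) (h𝒞 : ∀ B ∈ 𝒜, ∀ C ∈ 𝒜, r B ≤ r C → B \ C ∈ 𝒞)
    (t : K) (c : Finset α → K)
    (hdep : ∀ E ∈ 𝒞, ∑ C ∈ 𝒜, c C * ((if E ⊆ C then (1 : K) else 0) +
      t * (if Disjoint E C then (1 : K) else 0)) = 0)
    (hloc : ∀ A ∈ 𝒜, ∀ w : Finset α → K,
      (∀ W ∈ (𝒜.filter (fun C => r A ≤ r C)).image (fun C => A \ C),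
        ∑ X ∈ (𝒜.filter (fun C => r A ≤ r C)).image (fun C => A \ C),
          ((if Disjoint W X then (1 : K) else 0) + t * (if W ⊆ X then (1 : K) else 0)) * w X = 0) →
      w ∅ = 0) :
    ∀ A ∈ 𝒜, c A = 0 := by
  classical
  suffices h : ∀ n : ℕ, ∀ A ∈ 𝒜, r A < n → c A = 0 from
    fun A hA => h (r A + 1) A hA (Nat.lt_succ_self _)
  intro n
  induction n with
  | zero => intro A _ h; exact absurd h (Nat.not_lt_zero _)
  | succ n ih =>
    intro A hA hAn
    rcases Nat.lt_succ_iff_lt_or_eq.mp hAn with hlt | heq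
    · exact ih A hA hlt
    · set 𝒜' : Finset (Finset α) := 𝒜.filter (fun C => r A ≤ r C) with h𝒜'
      set 𝒲 : Finset (Finset α) := 𝒜'.image (fun C => A \ C) with h𝒲
      let w : Finset α → K := fun X => ∑ C ∈ 𝒜'.filter (fun C => A \ C = X), c C
      -- the local equations hold for `w`
      have hw : ∀ W ∈ 𝒲, ∑ X ∈ 𝒲, ((if Disjoint W X then (1 : K) else 0) +
          t * (if W ⊆ X then (1 : K) else 0)) * w X = 0 := by
        intro W hW
        obtain ⟨B, hB, hBW⟩ := mem_image.mp hW
        have hB𝒜 : B ∈ 𝒜 := (mem_filter.mp hB).1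
        have hrB : r A ≤ r B := (mem_filter.mp hB).2
        have h0 := hdep (A \ B) (h𝒞 A hA B hB𝒜 hrB)
        rw [← sum_filter_add_sum_filter_not 𝒜 (fun C => r A ≤ r C)] at h0
        have hrest : ∑ C ∈ 𝒜.filter (fun C => ¬ r A ≤ r C), c C * ((if A \ B ⊆ C then (1 : K) else 0) +
            t * (if Disjoint (A \ B) C then (1 : K) else 0)) = 0 := by
          refine sum_eq_zero fun C hC => ?_
          obtain ⟨hC𝒜, hrC⟩ := mem_filter.mp hC
          rw [ih C hC𝒜 (by omega), zero_mul]
        rw [hrest, add_zero] at h0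
        -- regroup the sum over `𝒜'` by the fibres of `C ↦ A \ C`
        have hfib : ∑ X ∈ 𝒲, ((if Disjoint W X then (1 : K) else 0) +
            t * (if W ⊆ X then (1 : K) else 0)) * w X =
            ∑ C ∈ 𝒜', c C * ((if A \ B ⊆ C then (1 : K) else 0) +
              t * (if Disjoint (A \ B) C then (1 : K) else 0)) := by
          have hmaps : ∀ C ∈ 𝒜', A \ C ∈ 𝒲 := fun C hC => mem_image_of_mem _ hC
          rw [← sum_fiberwise_of_maps_to hmaps]
          refine sum_congr rfl fun X _ => ?_
          rw [mul_sum]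
          refine sum_congr rfl fun C hC => ?_
          obtain ⟨_, hCX⟩ := mem_filter.mp hC
          -- the two incidences coincide: `[A \ B ⊆ C] = [(A \ B) ∩ (A \ C) = ∅]`, `[(A \ B) ∩ C = ∅] = [A \ B ⊆ A \ C]`
          have e1 : (A \ B ⊆ C) ↔ Disjoint W X := by
            rw [← hBW, ← hCX, disjoint_left]
            constructor
            · intro h x hx hx'
              exact (mem_sdiff.mp hx').2 (h hx)
            · intro h x hx
              by_contra hxC
              exact h hx (mem_sdiff.mpr ⟨(mem_sdiff.mp hx).1, hxC⟩)
          have e2 : Disjoint (A \ B) C ↔ W ⊆ X := by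
            rw [← hBW, ← hCX, disjoint_left]
            constructor
            · intro h x hx
              exact mem_sdiff.mpr ⟨(mem_sdiff.mp hx).1, h hx⟩
            · intro h x hx hxC
              exact (mem_sdiff.mp (h hx)).2 hxC
          rw [mul_comm]
          congr 2
          · exact if_congr e1.symm rfl rfl
          · congr 1
            exact if_congr e2.symm rfl rfl
        rw [hfib, h0]
      have h := hloc A hA w hw
      -- the fibre of `∅` is `{A}` by admissibility
      have hA' : A ∈ 𝒜' := mem_filter.mpr ⟨hA, le_rfl⟩
      have e : 𝒜'.filter (fun C => A \ C = ∅) = {A} := by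
        ext C
        simp only [mem_filter, mem_singleton, sdiff_eq_empty_iff_subset]
        constructor
        · rintro ⟨hC, hAC⟩
          obtain ⟨hC𝒜, hrC⟩ := mem_filter.mp hC
          by_contra hne
          exact hr A hA C hC𝒜 (Ne.symm hne) hrC hAC
        · rintro rfl
          exact ⟨hA', subset_rfl⟩
      change ∑ C ∈ 𝒜'.filter (fun C => A \ C = ∅), c C = 0 at h
      rwa [e, sum_singleton] at h

/-- **Back peeling (trace local matrices).**  Let `r` rank the members of `𝒜` so that `r C ≤ r B`, `B ≠ C ⟹ B ⊄ C`
(no member contains a member of larger rank; e.g. `r C = #C`), let `𝒞` contain `B \ C` whenever `r C ≤ r B`, and let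
`c` be a dependency of the pencil rows at `t` on `𝒞`.  If for every `A ∈ 𝒜` the local matrix `[V ⊆ X] + t [V ∩ X = ∅]` on the trace family
`𝒱_A = {B \ A : B ∈ 𝒜, r A ≤ r B}` (traces on the complement of `A` of the members not after `A`) kills the
coordinate `∅` of its kernel (every local solution `w` has `w ∅ = 0`; MEMBERSHIP form), then `c = 0` on `𝒜`. -/
theorem dep_eq_zero_of_traceLocal_mem (𝒜 : Finset (Finset α)) (r : Finset α → ℕ)
    (hr : ∀ B ∈ 𝒜, ∀ C ∈ 𝒜, B ≠ C → r C ≤ r B → ¬ B ⊆ C)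
    (𝒞 : Finset (Finset α)) (h𝒞 : ∀ B ∈ 𝒜, ∀ C ∈ 𝒜, r C ≤ r B → B \ C ∈ 𝒞)
    (t : K) (c : Finset α → K)
    (hdep : ∀ E ∈ 𝒞, ∑ C ∈ 𝒜, c C * ((if E ⊆ C then (1 : K) else 0) +
      t * (if Disjoint E C then (1 : K) else 0)) = 0)
    (hloc : ∀ A ∈ 𝒜, ∀ w : Finset α → K,
      (∀ V ∈ (𝒜.filter (fun B => r A ≤ r B)).image (fun B => B \ A),
        ∑ X ∈ (𝒜.filter (fun B => r A ≤ r B)).image (fun B => B \ A),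
          ((if V ⊆ X then (1 : K) else 0) + t * (if Disjoint V X then (1 : K) else 0)) * w X = 0) →
      w ∅ = 0) :
    ∀ A ∈ 𝒜, c A = 0 := by
  classical
  suffices h : ∀ n : ℕ, ∀ A ∈ 𝒜, r A < n → c A = 0 from
    fun A hA => h (r A + 1) A hA (Nat.lt_succ_self _)
  intro n
  induction n with
  | zero => intro A _ h; exact absurd h (Nat.not_lt_zero _)
  | succ n ih =>
    intro A hA hAn
    rcases Nat.lt_succ_iff_lt_or_eq.mp hAn with hlt | heq
    · exact ih A hA hlt
    · set 𝒜' : Finset (Finset α) := 𝒜.filter (fun B => r A ≤ r B) with h𝒜'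
      set 𝒱 : Finset (Finset α) := 𝒜'.image (fun B => B \ A) with h𝒱
      let w : Finset α → K := fun X => ∑ C ∈ 𝒜'.filter (fun C => C \ A = X), c C
      have hw : ∀ V ∈ 𝒱, ∑ X ∈ 𝒱, ((if V ⊆ X then (1 : K) else 0) +
          t * (if Disjoint V X then (1 : K) else 0)) * w X = 0 := by
        intro V hV
        obtain ⟨B, hB, hBV⟩ := mem_image.mp hV
        have hB𝒜 : B ∈ 𝒜 := (mem_filter.mp hB).1
        have hrB : r A ≤ r B := (mem_filter.mp hB).2
        have h0 := hdep (B \ A) (h𝒞 B hB𝒜 A hA hrB)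
        rw [← sum_filter_add_sum_filter_not 𝒜 (fun C => r A ≤ r C)] at h0
        have hrest : ∑ C ∈ 𝒜.filter (fun C => ¬ r A ≤ r C), c C * ((if B \ A ⊆ C then (1 : K) else 0) +
            t * (if Disjoint (B \ A) C then (1 : K) else 0)) = 0 := by
          refine sum_eq_zero fun C hC => ?_
          obtain ⟨hC𝒜, hrC⟩ := mem_filter.mp hC
          rw [ih C hC𝒜 (by omega), zero_mul]
        rw [hrest, add_zero] at h0
        have hfib : ∑ X ∈ 𝒱, ((if V ⊆ X then (1 : K) else 0) +
            t * (if Disjoint V X then (1 : K) else 0)) * w X =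
            ∑ C ∈ 𝒜', c C * ((if B \ A ⊆ C then (1 : K) else 0) +
              t * (if Disjoint (B \ A) C then (1 : K) else 0)) := by
          have hmaps : ∀ C ∈ 𝒜', C \ A ∈ 𝒱 := fun C hC => mem_image_of_mem _ hC
          rw [← sum_fiberwise_of_maps_to hmaps]
          refine sum_congr rfl fun X _ => ?_
          rw [mul_sum]
          refine sum_congr rfl fun C hC => ?_
          obtain ⟨_, hCX⟩ := mem_filter.mp hC
          -- `[B \ A ⊆ C] = [B \ A ⊆ C \ A]`, `[(B \ A) ∩ C = ∅] = [(B \ A) ∩ (C \ A) = ∅]`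
          have e1 : (B \ A ⊆ C) ↔ V ⊆ X := by
            rw [← hBV, ← hCX]
            constructor
            · intro h x hx
              exact mem_sdiff.mpr ⟨h hx, (mem_sdiff.mp hx).2⟩
            · intro h x hx
              exact (mem_sdiff.mp (h hx)).1
          have e2 : Disjoint (B \ A) C ↔ Disjoint V X := by
            rw [← hBV, ← hCX, disjoint_left, disjoint_left]
            constructor
            · intro h x hx hx'
              exact h hx (mem_sdiff.mp hx').1
            · intro h x hx hxC
              exact h hx (mem_sdiff.mpr ⟨hxC, (mem_sdiff.mp hx).2⟩)
          rw [mul_comm]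
          congr 2
          · exact if_congr e1.symm rfl rfl
          · congr 1
            exact if_congr e2.symm rfl rfl
        rw [hfib, h0]
      have h := hloc A hA w hw
      have hA' : A ∈ 𝒜' := mem_filter.mpr ⟨hA, le_rfl⟩
      have e : 𝒜'.filter (fun C => C \ A = ∅) = {A} := by
        ext C
        simp only [mem_filter, mem_singleton, sdiff_eq_empty_iff_subset]
        constructor
        · rintro ⟨hC, hCA⟩
          obtain ⟨hC𝒜, hrC⟩ := mem_filter.mp hC
          by_contra hne
          exact hr C hC𝒜 A hA hne hrC hCA
        · rintro rfl
          exact ⟨hA', subset_rfl⟩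
      change ∑ C ∈ 𝒜'.filter (fun C => C \ A = ∅), c C = 0 at h
      rwa [e, sum_singleton] at h


end OrderedDifferences

end Summit.CriticalPhenomena.PercolationContinuityZ3.Theorems
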